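import Literature.NumberTheory.IwasawaTheory.Greenberg2016.CoefficientLevels
import HarnessLib

/-!
# `Ш²(K, Σ, 𝐃) = ⋃_k im Ш²(K, Σ, D_k)` along an exhaustive tower of stable submodules (theorems only)

Topic `NumberTheory/IwasawaTheory/Greenberg2016`; namespace
`Literature.NumberTheory.IwasawaTheory.Greenberg2016`; THEOREMS ONLY (no definition, no named fact, no
`sorry`, no instance).  Lane «SUR-Λ» of cell `bsd-eis` (road memo `SUR-LAMBDA-ROAD-w5g9.md` §2 ★(γ),
brick C7b part 1: the `𝐃`-side of the `Λ`-adic Ш-pairing (6) of Greenberg 2010),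
`--supports stmt-BirchSwinnertonDyer-19032`.

For `ρ : ContinuousRep (GaloisGroupUnramifiedOutside K S) Λ 𝐃` (`𝐃` discrete), a monotone exhaustive
ℕ-tower `N k` of `Gal(K_Σ/K)`-stable `Λ`-submodules (`ρ_k := ρ.subrepresentation (N k) _`) and finite
`Σ`: every class of `Ш²(K, Σ, 𝐃) = sha2 S ρ` (locally trivial at all `v ∈ Σ`) is the image
`h_k x_k` of a LOCALLY TRIVIAL class `x_k ∈ sha2 S ρ_k` of some level (`exists_level_sha2_lift`):
lift `x` to some level `k₀` (the tree's `exists_Hmap_subtype_eq_two`), then each of the finitely many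
local images `loc_v x_{k₀}` (`v ∈ Σ`), which dies in `H²(K_v, 𝐃)`, dies at a deeper level
(`ContinuousRep.exists_cohomologyMap_eq_zero_two` for the compact `Γ_{K_v}`), so at a common deeper
level the lift is locally trivial.  Also `loc_Hmap_inclusion_comm` (localisation commutes with the
transitions).  This is the "`Ш²(K, Σ, 𝐃) = lim→ Ш²(K, Σ, 𝐃[𝔪ᵏ])`" used when Greenberg's pairing (6)
`Ш²(K, Σ, 𝐃) × Ш¹(K, Σ, T*) → ℚ_p/ℤ_p` is assembled from the finite-level Ш-dualities.

HONESTY: plumbing; no duality and nothing about BSD is proved here.  AI formalisation, weaker than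
expert review; the statements are established only by the kernel check.

## References
* R. Greenberg, *Surjectivity of the global-to-local map defining a Selmer group*, Kyoto J. Math.
  50 (2010) 853–888, §2.1 (6) p. 7, §2.2 Ш² (p. 6). [Greenberg2010]
* J.-P. Serre, *Galois Cohomology* (1997), I §2.2 Prop. 8. [SerreGaloisCohomology1997]
-/

noncomputable section

open scoped Classical
open Function CategoryTheory NumberField IsDedekindDomain Field
open _root_.TopRep _root_.ContRepresentation _root_.ContinuousCohomology
open Literature.NumberTheory.GaloisRepresentations
open Literature.NumberTheory.GaloisRepresentations.DiscreteGaloisModule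

namespace Literature.NumberTheory.IwasawaTheory.Greenberg2016

variable {K : Type} [Field K] [NumberField K] (S : Set (HeightOneSpectrum (𝓞 K)))
  {Λ : Type} [CommRing Λ] [TopologicalSpace Λ]
  {D : Type} [AddCommGroup D] [Module Λ D] [TopologicalSpace D] [DiscreteTopology D]
  [ContinuousSMul Λ D]
  (ρ : ContinuousRep (GaloisGroupUnramifiedOutside K S) Λ D)
  (N : ℕ → Submodule Λ D)
  (hN : ∀ (k : ℕ) (g : GaloisGroupUnramifiedOutside K S), N k ≤ (N k).comap (ρ g))

/-! ### §1. `Ш²(K, Σ, 𝐃) = ⋃_k im Ш²(K, Σ, D_k)` -/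

/-- Localisation commutes with the transition `H²(K_Σ/K, N k) → H²(K_Σ/K, N m)` (`k ≤ m`).
[cite: Greenberg2016Selmer, §3.2 p. 12 L10–14] -/
theorem loc_Hmap_inclusion_comm (hmono : Monotone N) {k m : ℕ} (h : k ≤ m) (v : Place K) (n : ℕ)
    (z : (ρ.subrepresentation (N k) (hN k)).H n) :
    loc S (ρ.subrepresentation (N m) (hN m)) v n
        (Hmap (ρ.subrepresentation (N k) (hN k)) (ρ.subrepresentation (N m) (hN m))
          ⟨Submodule.inclusion (hmono h), continuous_of_discreteTopology⟩ (fun _ _ ↦ rfl) n z) =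
      Hmap (localRep S (ρ.subrepresentation (N k) (hN k)) v)
        (localRep S (ρ.subrepresentation (N m) (hN m)) v)
        ⟨Submodule.inclusion (hmono h), continuous_of_discreteTopology⟩ (fun _ _ ↦ rfl) n
        (loc S (ρ.subrepresentation (N k) (hN k)) v n z) :=
  map_hom_map_hom_eq_of_square
    (X := (ρ.subrepresentation (N k) (hN k)).toTopRep) (Y := (ρ.subrepresentation (N m) (hN m)).toTopRep)
    (Y' := (localRep S (ρ.subrepresentation (N k) (hN k)) v).toTopRep)
    (Z := (localRep S (ρ.subrepresentation (N m) (hN m)) v).toTopRep)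
    (ContinuousMonoidHom.id _)
    (TopRep.ofHom ⟨⟨Submodule.inclusion (hmono h), continuous_of_discreteTopology⟩, fun g ↦ by ext; rfl⟩)
    (localToUnramified S v) (TopRep.ofHom ⟨ContinuousLinearMap.id Λ _, fun _ ↦ rfl⟩)
    (localToUnramified S v) (TopRep.ofHom ⟨ContinuousLinearMap.id Λ _, fun _ ↦ rfl⟩)
    (ContinuousMonoidHom.id _)
    (TopRep.ofHom ⟨⟨Submodule.inclusion (hmono h), continuous_of_discreteTopology⟩, fun g ↦ by ext; rfl⟩)
    (fun _ ↦ rfl) (fun _ ↦ rfl) n z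

/-- **`Ш²(K, Σ, 𝐃) = ⋃_k im Ш²(K, Σ, D_k)`**: every locally trivial class `x` of `H²(K_Σ/K, 𝐃)` is
the image of a LOCALLY TRIVIAL class `x_k` of some level `H²(K_Σ/K, D_k)` (lift `x` to some level,
then kill the finitely many local images `loc_v x_{k₀}`, `v ∈ Σ` — each dies at a deeper level since
`loc_v x = 0` — at a common deeper level). [cite: Greenberg2010, §2.1 (6) p. 7]
[cite: SerreGaloisCohomology1997, I §2.2 Prop. 8] -/
theorem exists_level_sha2_lift [Finite (SigmaPlace S)] (hmono : Monotone N) (hex : ∀ d : D, ∃ k, d ∈ N k) (x : ρ.H 2)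
    (hx : x ∈ sha2 S ρ) :
    ∃ (k : ℕ) (xk : (ρ.subrepresentation (N k) (hN k)).H 2), xk ∈ sha2 S (ρ.subrepresentation (N k) (hN k)) ∧
      Hmap (ρ.subrepresentation (N k) (hN k)) ρ (N k).subtypeL (fun _ _ ↦ rfl) 2 xk = x := by
  letI : Fintype (SigmaPlace S) := Fintype.ofFinite _
  obtain ⟨k₀, x₀, rfl⟩ := exists_Hmap_subtype_eq_two S ρ N hN hmono.directed_le hex x
  -- at each `v ∈ Σ`, `loc_v x₀` dies at some deeper level
  have hv : ∀ v : SigmaPlace S, ∃ j : ℕ, ∃ hj : N k₀ ≤ N j,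
      Hmap (localRep S (ρ.subrepresentation (N k₀) (hN k₀)) v.1)
        (localRep S (ρ.subrepresentation (N j) (hN j)) v.1)
        ⟨Submodule.inclusion hj, continuous_of_discreteTopology⟩ (fun _ _ ↦ rfl) 2
        (loc S (ρ.subrepresentation (N k₀) (hN k₀)) v.1 2 x₀) = 0 := by
    intro v
    haveI : CompactSpace (absoluteGaloisGroup v.1.Completion) := absoluteGaloisGroup_compactSpace _
    have h0 : Hmap (localRep S (ρ.subrepresentation (N k₀) (hN k₀)) v.1) (localRep S ρ v.1)
        (N k₀).subtypeL (fun _ _ ↦ rfl) 2 (loc S (ρ.subrepresentation (N k₀) (hN k₀)) v.1 2 x₀) = 0 := by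
      rw [← loc_Hmap_subtype_comm]
      exact (mem_sha2_iff S ρ _).1 hx v
    obtain ⟨j, hj, h⟩ := (localRep S ρ v.1).exists_cohomologyMap_eq_zero_two N (fun k _ ↦ hN k _)
      hmono.directed_le hex (loc S (ρ.subrepresentation (N k₀) (hN k₀)) v.1 2 x₀)
      (TopRep.ofHom ⟨(N k₀).subtypeL, fun g ↦ by ext; rfl⟩) (fun _ ↦ rfl) h0
    exact ⟨j, hj, h (TopRep.ofHom ⟨⟨Submodule.inclusion hj, continuous_of_discreteTopology⟩,
      fun g ↦ by ext; rfl⟩) fun _ ↦ rfl⟩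
  choose j hj hjv using hv
  -- a common level above `k₀` and all `j v`
  let m : ℕ := max k₀ (Finset.univ.sup j)
  have hk₀m : k₀ ≤ m := le_max_left _ _
  have hjm : ∀ v, j v ≤ m := fun v ↦ (Finset.le_sup (Finset.mem_univ v)).trans (le_max_right _ _)
  refine ⟨m, Hmap (ρ.subrepresentation (N k₀) (hN k₀)) (ρ.subrepresentation (N m) (hN m))
    ⟨Submodule.inclusion (hmono hk₀m), continuous_of_discreteTopology⟩ (fun _ _ ↦ rfl) 2 x₀, ?_,
    Hmap_subtype_Hmap_inclusion S ρ N hN (hmono hk₀m) 2 (Or.inr rfl) x₀⟩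
  rw [mem_sha2_iff]
  intro v
  rw [loc_Hmap_inclusion_comm S ρ N hN hmono hk₀m]
  haveI : CompactSpace (absoluteGaloisGroup v.1.Completion) := absoluteGaloisGroup_compactSpace _
  -- `incl_{k₀→m} = incl_{j v → m} ∘ incl_{k₀ → j v}` on `H²(K_v, ·)`
  have hcomp := ContinuousRep.cohomologyMap_comp_apply_of_eq_two
    (σ := (localRep S ρ v.1).subrepresentation (N k₀) (fun _ ↦ hN k₀ _))
    (σ' := (localRep S ρ v.1).subrepresentation (N (j v)) (fun _ ↦ hN (j v) _))
    (ρ := (localRep S ρ v.1).subrepresentation (N m) (fun _ ↦ hN m _))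
    (TopRep.ofHom ⟨⟨Submodule.inclusion (hj v), continuous_of_discreteTopology⟩, fun g ↦ by ext; rfl⟩)
    (TopRep.ofHom ⟨⟨Submodule.inclusion (hmono (hjm v)), continuous_of_discreteTopology⟩,
      fun g ↦ by ext; rfl⟩)
    (TopRep.ofHom ⟨⟨Submodule.inclusion (hmono hk₀m), continuous_of_discreteTopology⟩,
      fun g ↦ by ext; rfl⟩) (fun _ ↦ rfl) (loc S (ρ.subrepresentation (N k₀) (hN k₀)) v.1 2 x₀)
  refine hcomp.symm.trans ?_
  have h0 : cohomologyMap (TopRep.ofHom ⟨⟨Submodule.inclusion (hj v), continuous_of_discreteTopology⟩,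
      fun g ↦ by ext; rfl⟩ : ((localRep S ρ v.1).subrepresentation (N k₀) (fun _ ↦ hN k₀ _)).toTopRep ⟶
        ((localRep S ρ v.1).subrepresentation (N (j v)) (fun _ ↦ hN (j v) _)).toTopRep) 2
      (loc S (ρ.subrepresentation (N k₀) (hN k₀)) v.1 2 x₀) = 0 := hjv v
  rw [h0, map_zero]
  rfl

end Literature.NumberTheory.IwasawaTheory.Greenberg2016
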